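import Literature.NumberTheory.GelbartRogawski1991.DoubledWeilRepresentationArchHalf
import Literature.NumberTheory.GelbartRogawski1991.CMSplittingCharArchComponents
import Literature.NumberTheory.GelbartRogawski1991.DoubledWeilRepresentationCMExplicit
import Literature.NumberTheory.Automorphic.Liu2021.Def411WeilCarriersDoublingUnique
import Literature.NumberTheory.Automorphic.UnitaryGroupArchDetZPow
import HarnessLib

/-!
# The archimedean half of the `χ`-normalised doubled Weil representation AS A TERM, and the archimedean component of
# THE doubled Weil representation attached to `χ` ([GelbartRogawski1991, Prop. 3.1.1] by doubling; [Kudla1994, Thm. 3.1])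

Topic `NumberTheory/GelbartRogawski1991`; namespaces `…GelbartRogawski1991.UnitaryDualPair.ArchSplitting` (§1),
`…Automorphic.Liu2021.Def411WeilCarriersDoubling` (§2), `…GelbartRogawski1991.GRConstruction` (§3).  KERNEL ONLY: proved theorems and
two definitions with bodies (`etaD`, `archHalfOf`); 0 records, 0 named facts, 0 `sorry`.

The tree proves `exists_isArchHalf : ∃ sa, IsArchHalf χ sa` (`DoubledWeilRepresentationArchHalf`; witness `archWeilHalf ⊗ η`, Folland's
`det^{1/2}`-normalised section twisted by a `det`-power character `η` hidden behind the `∃` of `exists_archDetTwist_chiDet` ←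
`IsSplittingChar.exists_archDetTwist[_doubled]` ← `exists_archDetZPow`) and the UNIQUENESS of the `χ`-normalised doubled Weil representation
(`DoubledWeilUniqueness.isDoubledWeilRep_unique`, `Def411WeilCarriersDoubling.doubledWeilRep_eq_of_isDoubledWeilRep`).  This leaf names the witnesses:
* § 1 `archDetZPow_sq_mul_prod_inv_eq[_doubled]` — the twist identities `η_t(g)² · ∏_v det(g_{w(v)})⁻¹ = χ(·)²` for a GIVEN odd unitary archimedean
  type `t` of `χ`, `η_t := archDetZPow ((t ∘ wOf + 1)/2)` (the tree's proofs, witnesses named);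
* § 2 **`doubledWeilRep_archToAdelic_eq`**: for EVERY archimedean half `sa`, `doubledWeilRep χ (g_∞, 1) = sa g_∞` (uniqueness + GR-2's explicit assembly
  `DoubledWeilRepresentationCMExplicit.cmDoubledWeilRep_archToAdelic` ∕ `eq_cmDoubledWeilRep_of_isDoubledWeilRep`); hence `isArchHalf_unique`;
* § 3a `vac_archWeilSectionS`: the vacuum coefficient of Folland's section at ANY `g` is `(det d(G ⊗ 1))⁻¹`, `G` the sign-frame block assembly
  (`vac_weilHomV`; on a sign-block compact `k = (k⁺, k⁻)` this is `∏_v (det k⁻_v)⁻¹`, `vac_weilHom_kV`);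
* § 3 **`archHalfOf t := archWeilHalf ⊗ etaD t`**, `isArchHalf_archHalfOf` (`χ.HasUnitaryArchType t 0`, `t` odd ⇒ an archimedean half — the term
  of `exists_isArchHalf`) and **`doubledWeilRep_archToAdelic_eq_archHalfOf`**: `doubledWeilRep χ (g_∞, 1) = (archWeilHalf ⊗ η_t) g_∞`.
So the archimedean component of `chiSplitting χ = undoubleHom (doubledWeilRep χ)` ([HarrisKudlaSweet1996] `ι̃_{V,χ}`, [Liu2021, App. D Step 2] `ι_μ`)
is Folland's section times `∏_v det(g_{w(v)})^{(t_{w(v)}+1)/2}`, and on a sign-block compact element `k` the doubled Fock vacuum coefficient is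
`∏_v det(k_v)^{(t_{w(v)}+1)/2} (det k⁻_v)⁻¹` — the input of the vacuum ∕ central-type computation of the COR-CM X3-Char item (E) (KK07 Lemma 5.2
step and the undoubling to the pair Gaussian are NOT done here).  The `∃` theorems keep their statements.  HC_CM is NOT proved here or anywhere.

References: S. Gelbart, J. Rogawski, Invent. Math. 105 (1991), §3.1 Prop. 3.1.1 p. 455 [GelbartRogawski1991]; S. Kudla, Israel J. Math.
87 (1994), §3 Thm. 3.1 [Kudla1994]; A. Paul, J. Funct. Anal. 159 (1998), §1.2 (1.2.1)–(1.2.2) [Paul1998]; M. Harris, S. Kudla, W. J.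
Sweet, J. Amer. Math. Soc. 9 (1996), §1 (1.11)–(1.16) [HarrisKudlaSweet1996]; Y. Liu, Camb. J. Math. 9 (2021), Remark 4.2, App. D Step 2
[Liu2021].  Provenance: pub-hodgecm2 cell, seat item6-p3 (gen 11), X3-Char (E) analytic residual, step (A).
-/

set_option autoImplicit false

noncomputable section

open scoped Classical
open scoped Matrix
open NumberField NumberField.InfinitePlace

/-! ## §1. The archimedean twist identities for a GIVEN odd unitary archimedean type of `χ` -/

namespace Literature.NumberTheory.GelbartRogawski1991.UnitaryDualPair.ArchSplitting
open Literature.NumberTheory.Automorphic Literature.NumberTheory.Automorphic.UnitaryGroup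
open Literature.NumberTheory.GaloisRepresentations
open Literature.RepresentationTheory.HarrisKudlaSweet1996
open scoped ComplexConjugate MatrixGroups
open IsDedekindDomain
open Literature.NumberTheory.GelbartRogawski1991.AdaptedBlocks

variable (L : Type) [Field L] [NumberField L] [IsCMField L]

variable {N : ℕ} (J : Matrix (Fin N) (Fin N) L) (hc : IsCMField.complexConj L ≠ 1)
  (wOf : {v : InfinitePlace (maximalRealSubfield L) // v.IsReal} → {w : InfinitePlace L // w.IsComplex})
  (hw : ∀ v, IsCMField.complexConj L • (wOf v).1 = (wOf v).1)
  (hover : ∀ v, (wOf v).1.comap (algebraMap (maximalRealSubfield L) L) = v.1)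

omit [NumberField L] [IsCMField L] in
/-- `(u^k)² u⁻¹ = u^{2k−1}` (private arithmetic helper). [folklore] -/
private theorem zpow_sq_mul_inv' {u : ℂ} (hu : u ≠ 0) (k : ℤ) : (u ^ k) ^ 2 * u⁻¹ = u ^ (2 * k - 1) := by
  rw [zpow_sub_one₀ hu, mul_comm (2 : ℤ) k, zpow_mul, zpow_two, sq]

omit [NumberField L] [IsCMField L] in
/-- `2·((e+1)/2) − 1 = e` for odd `e` (private arithmetic helper). [folklore] -/
private theorem two_mul_add_one_ediv_two_sub_one' {e : ℤ} (he : Odd e) : 2 * ((e + 1) / 2) - 1 = e := by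
  obtain ⟨m, rfl⟩ := he
  omega

include hover in
/-- **The archimedean twist of a splitting character, EXPLICIT**: for `χ` with unitary archimedean type `(e, 0)`, `e` odd, the
`det`-power character `η_e := archDetZPow ((e ∘ wOf + 1)/2)` satisfies `η_e(g)² · ∏_v det(g_{wOf v})⁻¹ = χ((x, 1))²` for every
`g ∈ U(J)(L ⊗ ℝ)` and every infinite idele `x` with `σ_w(x_w)/σ_w(x_w)‾ = det g_w` (`w = wOf v`) — the witness form of the tree's
`IsSplittingChar.exists_archDetTwist`. [cite: Paul1998, §1.2 (1.2.1)–(1.2.2) p. 389 L11–29] [cite: Liu2021, Remark 4.2] -/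
theorem archDetZPow_sq_mul_prod_inv_eq {χ : HeckeCharacter L} {e : InfinitePlace L → ℤ}
    (he : χ.HasUnitaryArchType e 0) (hodd : ∀ w, Odd (e w))
    (g : arch (maximalRealSubfield L) L (IsCMField.complexConj L) N J) (x : (InfiniteAdeleRing L)ˣ)
    (hx : ∀ v : {v : InfinitePlace (maximalRealSubfield L) // v.IsReal},
      Completion.extensionEmbedding (wOf v).1 ((x : InfiniteAdeleRing L) (wOf v).1) /
          conj (Completion.extensionEmbedding (wOf v).1 ((x : InfiniteAdeleRing L) (wOf v).1)) =
        (((archAt (maximalRealSubfield L) L (IsCMField.complexConj L) N J (wOf v) (hw v) hc g : archLocal L N J (wOf v)) :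
          GL (Fin N) ℂ) : Matrix (Fin N) (Fin N) ℂ).det) :
    ((archDetZPow (maximalRealSubfield L) L (IsCMField.complexConj L) N J hc wOf hw (fun v => (e (wOf v).1 + 1) / 2) g : ℂˣ) : ℂ) ^ 2 *
        ∏ v : {v : InfinitePlace (maximalRealSubfield L) // v.IsReal},
          ((((archAt (maximalRealSubfield L) L (IsCMField.complexConj L) N J (wOf v) (hw v) hc g : archLocal L N J (wOf v)) :
            GL (Fin N) ℂ) : Matrix (Fin N) (Fin N) ℂ).det)⁻¹ =
      ((χ (infiniteIdeles L x) : ℂˣ) : ℂ) ^ 2 := by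
  set d : {v : InfinitePlace (maximalRealSubfield L) // v.IsReal} → ℂ := fun v =>
    (((archAt (maximalRealSubfield L) L (IsCMField.complexConj L) N J (wOf v) (hw v) hc g : archLocal L N J (wOf v)) :
      GL (Fin N) ℂ) : Matrix (Fin N) (Fin N) ℂ).det
  have hd0 : ∀ v, d v ≠ 0 := fun v =>
    (Matrix.GeneralLinearGroup.det
      ((archAt (maximalRealSubfield L) L (IsCMField.complexConj L) N J (wOf v) (hw v) hc g : archLocal L N J (wOf v)) : GL (Fin N) ℂ)).ne_zero
  rw [coe_archDetZPow, sq_apply_infiniteIdeles_eq_prod L wOf hover he x, ← Finset.prod_pow, ← Finset.prod_mul_distrib]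
  refine Finset.prod_congr rfl fun v _ => ?_
  rw [hx v, zpow_sq_mul_inv' (hd0 v), two_mul_add_one_ediv_two_sub_one' (hodd _)]

section Doubled

variable {n : ℕ} (T : Matrix (Fin n) (Fin n) (maximalRealSubfield L)) (hT : IsUnit T.det)
  (JD : Matrix (Fin (n + n)) (Fin (n + n)) L)
  (hJD : JD = (Matrix.reindex finSumFinEquiv finSumFinEquiv (Matrix.fromBlocks T 0 0 (-T))).map
    (algebraMap (maximalRealSubfield L) L))

include hT hJD hover in
/-- **The explicit archimedean twist on the Siegel parabolic of the doubled unitary group** (witness form of the tree's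
`IsSplittingChar.exists_archDetTwist_doubled`): for `χ` of odd unitary archimedean type `(e, 0)`, `J^𝔻 = e₂(T ⊕ −T)e₂`, and
`η_e := archDetZPow ((e ∘ wOf + 1)/2)`: for every `g ∈ U(J^𝔻)(L ⊗ ℝ)` whose adelic matrix lies in `P_Δ` and every idele `u` equal
to Kudla's `x((g,1))`, `η_e(g)² · ∏_v det(g_{w(v)})⁻¹ = χ(u)²`. [cite: Kudla1994, §3] [cite: Paul1998, §1.2 (1.2.1)–(1.2.2) p. 389 L11–29] -/
theorem archDetZPow_sq_mul_prod_inv_eq_doubled {χ : HeckeCharacter L} {e : InfinitePlace L → ℤ}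
    (he : χ.HasUnitaryArchType e 0) (hodd : ∀ w, Odd (e w))
    (g : arch (maximalRealSubfield L) L (IsCMField.complexConj L) (n + n) JD) (u : ideleGroup L)
    (hS : (Matrix.reindex finSumFinEquiv.symm finSumFinEquiv.symm
              (((archToAdelic (maximalRealSubfield L) L (IsCMField.complexConj L) (n + n) JD g).1 :
                GL (Fin (n + n)) (AdeleRing (𝓞 L) L)) : Matrix (Fin (n + n)) (Fin (n + n)) (AdeleRing (𝓞 L) L))).toBlocks₁₁ +
            (Matrix.reindex finSumFinEquiv.symm finSumFinEquiv.symm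
              (((archToAdelic (maximalRealSubfield L) L (IsCMField.complexConj L) (n + n) JD g).1 :
                GL (Fin (n + n)) (AdeleRing (𝓞 L) L)) : Matrix (Fin (n + n)) (Fin (n + n)) (AdeleRing (𝓞 L) L))).toBlocks₁₂ =
          (Matrix.reindex finSumFinEquiv.symm finSumFinEquiv.symm
              (((archToAdelic (maximalRealSubfield L) L (IsCMField.complexConj L) (n + n) JD g).1 :
                GL (Fin (n + n)) (AdeleRing (𝓞 L) L)) : Matrix (Fin (n + n)) (Fin (n + n)) (AdeleRing (𝓞 L) L))).toBlocks₂₁ +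
            (Matrix.reindex finSumFinEquiv.symm finSumFinEquiv.symm
              (((archToAdelic (maximalRealSubfield L) L (IsCMField.complexConj L) (n + n) JD g).1 :
                GL (Fin (n + n)) (AdeleRing (𝓞 L) L)) : Matrix (Fin (n + n)) (Fin (n + n)) (AdeleRing (𝓞 L) L))).toBlocks₂₂)
    (hu : ((u : ideleGroup L) : AdeleRing (𝓞 L) L) =
          ((Matrix.reindex finSumFinEquiv.symm finSumFinEquiv.symm
              (((archToAdelic (maximalRealSubfield L) L (IsCMField.complexConj L) (n + n) JD g).1 :
                GL (Fin (n + n)) (AdeleRing (𝓞 L) L)) : Matrix (Fin (n + n)) (Fin (n + n)) (AdeleRing (𝓞 L) L))).toBlocks₁₁ +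
            (Matrix.reindex finSumFinEquiv.symm finSumFinEquiv.symm
              (((archToAdelic (maximalRealSubfield L) L (IsCMField.complexConj L) (n + n) JD g).1 :
                GL (Fin (n + n)) (AdeleRing (𝓞 L) L)) : Matrix (Fin (n + n)) (Fin (n + n)) (AdeleRing (𝓞 L) L))).toBlocks₁₂).det) :
    ((archDetZPow (maximalRealSubfield L) L (IsCMField.complexConj L) (n + n) JD hc wOf hw (fun v => (e (wOf v).1 + 1) / 2) g :
        ℂˣ) : ℂ) ^ 2 *
        ∏ v : {v : InfinitePlace (maximalRealSubfield L) // v.IsReal},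
          ((((archAt (maximalRealSubfield L) L (IsCMField.complexConj L) (n + n) JD (wOf v) (hw v) hc g :
              archLocal L (n + n) JD (wOf v)) : GL (Fin (n + n)) ℂ) : Matrix (Fin (n + n)) (Fin (n + n)) ℂ).det)⁻¹ =
      ((χ u : ℂˣ) : ℂ) ^ 2 := by
  -- abbreviations: the adelic matrix `M` of `(g,1)` and Kudla's `x = x((g,1)) ∈ 𝔸_L`
  set M : Matrix (Fin (n + n)) (Fin (n + n)) (AdeleRing (𝓞 L) L) :=
    (((archToAdelic (maximalRealSubfield L) L (IsCMField.complexConj L) (n + n) JD g).1 :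
      GL (Fin (n + n)) (AdeleRing (𝓞 L) L)) : Matrix (Fin (n + n)) (Fin (n + n)) (AdeleRing (𝓞 L) L)) with hM
  set x : AdeleRing (𝓞 L) L := ((Matrix.reindex finSumFinEquiv.symm finSumFinEquiv.symm M).toBlocks₁₁ +
      (Matrix.reindex finSumFinEquiv.symm finSumFinEquiv.symm M).toBlocks₁₂).det with hx
  -- the finite part of `x` is `1`
  have hx2 : x.2 = 1 := by
    have h := map_det_deltaBlock_finSum (adeleSnd L) M
    rw [hM, map_snd_coe_archToAdelic, det_deltaBlock_finSum_one] at h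
    exact h
  -- the infinite idele `y = x_∞` with `(y, 1) = u`
  let y : (InfiniteAdeleRing L)ˣ := Units.map (adeleFst L : AdeleRing (𝓞 L) L →* InfiniteAdeleRing L) u
  have hyu : infiniteIdeles L y = u := by
    apply Units.ext
    change ((((u : ideleGroup L) : AdeleRing (𝓞 L) L).1, (1 : IsDedekindDomain.FiniteAdeleRing (𝓞 L) L)) :
      AdeleRing (𝓞 L) L) = _
    rw [hu]
    exact Prod.ext rfl hx2.symm
  rw [← hyu]
  refine archDetZPow_sq_mul_prod_inv_eq L JD hc wOf hw hover he hodd g y fun v => ?_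
  -- at the place `w = wOf v`: `σ_w(x_w) = x(g_w)` and `det g_w · conj x(g_w) = x(g_w)`
  have hφ : Completion.extensionEmbedding (wOf v).1 ((y : InfiniteAdeleRing L) (wOf v).1) =
      ((Matrix.reindex finSumFinEquiv.symm finSumFinEquiv.symm
          (((archAt (maximalRealSubfield L) L (IsCMField.complexConj L) (n + n) JD (wOf v) (hw v) hc g :
            archLocal L (n + n) JD (wOf v)) : GL (Fin (n + n)) ℂ) : Matrix (Fin (n + n)) (Fin (n + n)) ℂ)).toBlocks₁₁ +
        (Matrix.reindex finSumFinEquiv.symm finSumFinEquiv.symm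
          (((archAt (maximalRealSubfield L) L (IsCMField.complexConj L) (n + n) JD (wOf v) (hw v) hc g :
            archLocal L (n + n) JD (wOf v)) : GL (Fin (n + n)) ℂ) : Matrix (Fin (n + n)) (Fin (n + n)) ℂ)).toBlocks₁₂).det := by
    have h := map_det_deltaBlock_finSum ((Completion.extensionEmbedding (wOf v).1).comp
      ((Pi.evalRingHom (fun v : InfinitePlace L => v.Completion) (wOf v).1).comp (adeleFst L))) M
    rw [hM, map_placeEval_coe_archToAdelic (maximalRealSubfield L) L (IsCMField.complexConj L) (n + n) JD (wOf v)
      (hw v) hc g] at h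
    rw [← h]
    change Completion.extensionEmbedding (wOf v).1 ((((u : ideleGroup L) : AdeleRing (𝓞 L) L)).1 (wOf v).1) = _
    rw [hu]
    rfl
  have hne : Completion.extensionEmbedding (wOf v).1 ((y : InfiniteAdeleRing L) (wOf v).1) ≠ 0 := by
    refine (map_ne_zero (Completion.extensionEmbedding (wOf v).1)).2 ?_
    exact (Units.map (Pi.evalMonoidHom (fun w : InfinitePlace L => w.Completion) (wOf v).1) y).ne_zero
  have hdet := det_archAt_mul_conj_eq L T hT JD hJD hc g hS (wOf v) (hw v)
  rw [← hφ] at hdet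
  rw [eq_comm, eq_div_iff ((map_ne_zero (starRingEnd ℂ)).2 hne)]
  exact hdet

end Doubled

end Literature.NumberTheory.GelbartRogawski1991.UnitaryDualPair.ArchSplitting

/-! ## §2. Every archimedean half IS the archimedean component of THE doubled Weil representation attached to `χ` -/

namespace Literature.NumberTheory.Automorphic.Liu2021.Def411WeilCarriersDoubling
open Literature.NumberTheory.GelbartRogawski1991 Literature.NumberTheory.GelbartRogawski1991.UnitaryDualPair
open Literature.NumberTheory.GelbartRogawski1991.GRConstruction
open Literature.NumberTheory.GaloisRepresentations
open Literature.RepresentationTheory.HarrisKudlaSweet1996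

variable (L : Type) [Field L] [NumberField L] [IsCMField L]

variable {N M n : ℕ} (e : Fin N × Fin M ≃ Fin n)
  (dV : Fin N → L) (hdV : ∀ i, IsCMField.complexConj L (dV i) = dV i) (hdV0 : ∀ i, dV i ≠ 0)
  (dW : Fin M → L) (hdW : ∀ i, IsCMField.complexConj L (dW i) = dW i) (hdW0 : ∀ i, dW i ≠ 0)

/-- **`s^𝔻_χ` restricted to `H(L⁺ ⊗ ℝ)` is ANY archimedean half**: for every `sa : H(L⁺ ⊗ ℝ) →* Mp(𝕎^𝔻)ᶜᵒⁿᵗ` with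
`IsArchHalf χ sa`, `doubledWeilRep χ (g_∞, 1) = sa g_∞` — two lines over GR-2's explicit assembly `DoubledWeilRepresentationCMExplicit`
(`eq_cmDoubledWeilRep_of_isDoubledWeilRep`: uniqueness against `cmDoubledWeilRep χ … ha = sa · s_f`; `cmDoubledWeilRep_archToAdelic`: its value
at an archimedean element is `sa`). So the archimedean component of [HarrisKudlaSweet1996]'s `ι̃_{V,χ}` ∕ [Liu2021, App. D Step 2]'s `ι_μ` is
read off ANY explicit archimedean half. [cite: Kudla1994, §3 Thm. 3.1] [cite: GelbartRogawski1991, §3.1 Prop. 3.1.1 p. 455 L1–2] -/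
theorem doubledWeilRep_archToAdelic_eq (χ : HeckeCharacter L) (hχu : χ.IsUnitary) (hχs : IsSplittingChar L 1 χ)
    {sa : UnitaryGroup.arch (Fp L) L (IsCMField.complexConj L) (n + n) (hermD L e dV hdV dW hdW) →* MpD L e dV hdV dW hdW}
    (ha : IsArchHalf L e dV hdV hdV0 dW hdW hdW0 χ sa)
    (g : UnitaryGroup.arch (Fp L) L (IsCMField.complexConj L) (n + n) (hermD L e dV hdV dW hdW)) :
    doubledWeilRep L e dV hdV hdV0 dW hdW hdW0 χ hχu hχs
        (UnitaryGroup.archToAdelic (Fp L) L (IsCMField.complexConj L) (n + n) (hermD L e dV hdV dW hdW) g) = sa g := by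
  have h := DFunLike.congr_fun (eq_cmDoubledWeilRep_of_isDoubledWeilRep L e dV hdV hdV0 dW hdW hdW0 χ hχs (haarData L) ha
    (isDoubledWeilRep_doubledWeilRep L e dV hdV hdV0 dW hdW hdW0 χ hχu hχs))
    (UnitaryGroup.archToAdelic (Fp L) L (IsCMField.complexConj L) (n + n) (hermD L e dV hdV dW hdW) g)
  exact h.trans (cmDoubledWeilRep_archToAdelic L e dV hdV hdV0 dW hdW hdW0 χ hχs (haarData L) ha g)

/-- … hence **all archimedean halves coincide**. [cite: Kudla1994, §3 Thm. 3.1] -/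
theorem isArchHalf_unique (χ : HeckeCharacter L) (hχu : χ.IsUnitary) (hχs : IsSplittingChar L 1 χ)
    {sa sa' : UnitaryGroup.arch (Fp L) L (IsCMField.complexConj L) (n + n) (hermD L e dV hdV dW hdW) →* MpD L e dV hdV dW hdW}
    (ha : IsArchHalf L e dV hdV hdV0 dW hdW hdW0 χ sa) (ha' : IsArchHalf L e dV hdV hdV0 dW hdW hdW0 χ sa') : sa = sa' :=
  MonoidHom.ext fun g => (doubledWeilRep_archToAdelic_eq L e dV hdV hdV0 dW hdW hdW0 χ hχu hχs ha g).symm.trans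
    (doubledWeilRep_archToAdelic_eq L e dV hdV hdV0 dW hdW hdW0 χ hχu hχs ha' g)

end Literature.NumberTheory.Automorphic.Liu2021.Def411WeilCarriersDoubling

/-! ## §3a. The vacuum coefficient of Folland's section (any `g`): `vac (archWeilSectionS g) = (det d(g ⊗ 1))⁻¹` in the sign frames -/

namespace Literature.NumberTheory.Weil1964
open Literature.NumberTheory.Automorphic Literature.NumberTheory.Automorphic.UnitaryGroup
open Literature.RepresentationTheory.KonnoKonno2007 Literature.RepresentationTheory.KonnoKonno2007.RealDualPair
open MpS UnitaryWeil

variable {F : Type} [Field F] [NumberField F] (E : Type) [Field E] [NumberField E] [Algebra F E] (c : E ≃ₐ[F] E)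
  (N : ℕ) (hc : c ≠ 1)
  (wOf : {v : InfinitePlace F // v.IsReal} → {w : InfinitePlace E // w.IsComplex})
  (hw : ∀ v, c • (wOf v).1 = (wOf v).1) (hover : ∀ v, (wOf v).1.comap (algebraMap F E) = v.1)
  (t₀ : Fin N → F) (ht0 : ∀ j, t₀ j ≠ 0) {T : Matrix (Fin N) (Fin N) F} (hTd : T = Matrix.diagonal t₀)
  {J : Matrix (Fin N) (Fin N) E} (hJ : J = T.map (algebraMap F E)) {δ : E} (hcδ : c δ = -δ) (hδ : δ ≠ 0)

/-- **the VACUUM COEFFICIENT of the archimedean section** ([Folland1989, Prop. (4.39)]: `ν(P)` acts on the Gaussian by `det^{-1/2}`; for the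
`det^{1/2}`-normalised section of [Paul1998, (1.2.1)] the tree's `vac_weilElt : C(weilElt G) = (det d(G))⁻¹`): for EVERY `g ∈ U(J)(E ⊗ ℝ)`,
`vac (archWeilSectionS g) = (det d(G ⊗ 1))⁻¹` with `G = placeDiag (archUFormPi g)` the block-diagonal assembly of the sign-frame components and
`d` the lower-right (negative-index) block — so on a sign-block compact element `k = (k⁺_v, k⁻_v)_v` it is `∏_v (det k⁻_v)⁻¹`
(`UnitaryWeil.vac_weilHom_kV` place by place). [cite: Folland1989, §4.2 Prop. (4.39)] [cite: Paul1998, §1.2 (1.2.1)–(1.2.2)] -/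
theorem vac_archWeilSectionS (g : UnitaryGroup.arch F E c N J) :
    MpS.vac (archWeilSectionS E c N hc wOf hw hover t₀ ht0 hTd hJ hcδ hδ g) =
      ((UnitaryBall.d (toBig _ _ Unit Empty
          (UForm.placeDiag (archUFormPi E c N hc wOf hw hover t₀ ht0 hTd hJ hcδ hδ g), 1))).det)⁻¹ := by
  have h := UnitaryWeil.vac_weilHomV (P := Σ v, PosIdx (signVec wOf t₀ δ v)) (Q := Σ v, NegIdx (signVec wOf t₀ δ v))
    (R := Unit) (S := Empty) (UForm.placeDiag (archUFormPi E c N hc wOf hw hover t₀ ht0 hTd hJ hcδ hδ g))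
  rw [archWeilSectionS_apply, MpS.vac_reindex]
  -- the `Fintype`/`DecidableEq` instance terms of the block index types differ syntactically (cf. `quot_archWeilSectionS`)
  convert h using 2

end Literature.NumberTheory.Weil1964

/-! ## §3. The archimedean half AS A TERM: Folland's `det^{1/2}`-section twisted by the explicit `det`-power character `η_e` -/

namespace Literature.NumberTheory.GelbartRogawski1991.GRConstruction
open UnitaryDualPair UnitaryDualPair.ArchSplitting
open Literature.NumberTheory.Automorphic Literature.NumberTheory.Automorphic.UnitaryGroup
open Literature.NumberTheory.Weil1964
open Literature.NumberTheory.GaloisRepresentations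
open Literature.RepresentationTheory.HarrisKudlaSweet1996
open Literature.NumberTheory.Automorphic.Liu2021

variable (L : Type) [Field L] [NumberField L] [IsCMField L]

variable {N M n : ℕ} (e : Fin N × Fin M ≃ Fin n)
  (dV : Fin N → L) (hdV : ∀ i, IsCMField.complexConj L (dV i) = dV i) (hdV0 : ∀ i, dV i ≠ 0)
  (dW : Fin M → L) (hdW : ∀ i, IsCMField.complexConj L (dW i) = dW i) (hdW0 : ∀ i, dW i ≠ 0)

/-- **the explicit twist character of the doubled group**: `η_t := ∏_v det(g_{w(v)})^{(t_{w(v)}+1)/2}` on `H(L⁺ ⊗ ℝ) = U(J^𝔻)(L ⊗ ℝ)`,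
`w(v) = cmPlaceOver L v`, for an archimedean type `t : InfinitePlace L → ℤ`. [cite: Paul1998, §1.2 (1.2.1)–(1.2.2) p. 389 L11–29] -/
def etaD (t : InfinitePlace L → ℤ) :
    UnitaryGroup.arch (Fp L) L (IsCMField.complexConj L) (n + n) (hermD L e dV hdV dW hdW) →* ℂˣ :=
  archDetZPow (Fp L) L (IsCMField.complexConj L) (n + n) (hermD L e dV hdV dW hdW) (IsCMField.complexConj_ne_one L)
    (cmPlaceOver L) (cmPlaceOver_smul L) fun v => (t (cmPlaceOver L v).1 + 1) / 2

include hdV0 hdW0 in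
/-- **the explicit archimedean twist in the `chiDet` language** (witness form of `exists_archDetTwist_chiDet`): for `χ` of odd unitary
archimedean type `(t, 0)` and every `g` with `(g, 1) ∈ P_Δ(𝔸)`: `η_t(g)² · ∏_v det(g_{w(v)})⁻¹ = χ(det_Δ (g,1))²`.
[cite: Kudla1994, §3] [cite: Paul1998, §1.2 (1.2.1)–(1.2.2) p. 389 L11–29] -/
theorem etaD_sq_mul_prod_inv_eq_chiDet {χ : HeckeCharacter L} {t : InfinitePlace L → ℤ}
    (ht : χ.HasUnitaryArchType t 0) (hodd : ∀ w, Odd (t w))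
    (g : UnitaryGroup.arch (Fp L) L (IsCMField.complexConj L) (n + n) (hermD L e dV hdV dW hdW))
    (hS : IsSiegelDelta L e dV hdV dW hdW
      (UnitaryGroup.archToAdelic (Fp L) L (IsCMField.complexConj L) (n + n) (hermD L e dV hdV dW hdW) g)) :
    ((etaD L e dV hdV dW hdW t g : ℂˣ) : ℂ) ^ 2 *
        ∏ v : {v : InfinitePlace (Fp L) // v.IsReal},
          ((((UnitaryGroup.archAt (Fp L) L (IsCMField.complexConj L) (n + n) (hermD L e dV hdV dW hdW) (cmPlaceOver L v)
              (cmPlaceOver_smul L v) (IsCMField.complexConj_ne_one L) g :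
              UnitaryGroup.archLocal L (n + n) (hermD L e dV hdV dW hdW) (cmPlaceOver L v)) :
              GL (Fin (n + n)) ℂ) : Matrix (Fin (n + n)) (Fin (n + n)) ℂ).det)⁻¹ =
      ((chiDet L e dV hdV dW hdW χ
        (UnitaryGroup.archToAdelic (Fp L) L (IsCMField.complexConj L) (n + n) (hermD L e dV hdV dW hdW) g) : ℂˣ) : ℂ) ^ 2 := by
  have hu := isUnit_detDelta_of_isSiegelDelta L e dV hdV dW hdW _ hS
  simp only [chiDet, dif_pos hu]
  exact archDetZPow_sq_mul_prod_inv_eq_doubled L (IsCMField.complexConj_ne_one L) (cmPlaceOver L) (cmPlaceOver_smul L)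
    (cmPlaceOver_comap L) (gramR L e dV hdV dW hdW) (isUnit_det_gramR₀ L e dV hdV hdV0 dW hdW hdW0) (hermD L e dV hdV dW hdW)
    (hermD_eq_map_reindex_fromBlocks L e dV hdV dW hdW) ht hodd g hu.unit hS hu.unit_spec

/-- **Folland's `det^{1/2}`-section of the doubled group, lifted** (`Weil1964.archWeilHalf` at `J^𝔻 = hermD`, the `cmPlaceOver` sign
frames and the scaled Folland frame of the doubled diagonal Gram matrix — the `sa` of `exists_isArchHalf`), as ONE named term.
[cite: GelbartRogawski1991, §3.1 Prop. 3.1.1 p. 455] [cite: Paul1998, §1.2 (1.2.1) p. 389] -/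
def archWeilHalfD :
    UnitaryGroup.arch (Fp L) L (IsCMField.complexConj L) (n + n) (hermD L e dV hdV dW hdW) →* MpD L e dV hdV dW hdW :=
  archWeilHalf L (IsCMField.complexConj L) (n + n) (IsCMField.complexConj_ne_one L) (cmPlaceOver L) (cmPlaceOver_smul L)
    (cmPlaceOver_comap L) _ (gramD_gram_realDiagonal_entry_ne_zero L e dV hdV dW hdW hdV0 hdW0) (gramD_eq_diagonal_cm L e dV hdV dW hdW)
    (J := hermD L e dV hdV dW hdW) rfl (complexConj_imagUnit L) (imagUnit_ne_zero L) (imagUnit_mul_self L)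
    (gramD_isSymm L e dV hdV dW hdW) (isUnit_archMat_gramDA L e dV hdV hdV0 dW hdW hdW0)

/-- **THE ARCHIMEDEAN HALF AS A TERM**: `s_∞(χ, t) := archWeilHalf^𝔻 ⊗ η_t`, for an archimedean type `t` (meant: THE odd unitary archimedean
type of `χ`) — the witness of the tree's `exists_isArchHalf` with its `∃ η` named. [cite: GelbartRogawski1991, §3.1 Prop. 3.1.1 p. 455] [cite: Paul1998, §1.2 (1.2.1)–(1.2.2) p. 389] -/
def archHalfOf (t : InfinitePlace L → ℤ) :
    UnitaryGroup.arch (Fp L) L (IsCMField.complexConj L) (n + n) (hermD L e dV hdV dW hdW) →* MpD L e dV hdV dW hdW :=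
  adelicMpCont.twist (Fp L) (Fin (n + n)) (gramDA L e dV hdV dW hdW) (archWeilHalfD L e dV hdV hdV0 dW hdW hdW0) (etaD L e dV hdV dW hdW t)

/-- **`s_∞(χ, t)` IS an archimedean half of the `χ`-normalised doubled Weil representation** when `t` is an odd unitary archimedean type
of `χ` (the tree's `exists_isArchHalf`, with the witness named). [cite: GelbartRogawski1991, §3.1 Prop. 3.1.1 p. 455] -/
theorem isArchHalf_archHalfOf {χ : HeckeCharacter L} {t : InfinitePlace L → ℤ}
    (ht : χ.HasUnitaryArchType t 0) (hodd : ∀ w, Odd (t w)) :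
    IsArchHalf L e dV hdV hdV0 dW hdW hdW0 χ (archHalfOf L e dV hdV hdV0 dW hdW hdW0 t) := by
  have hc : IsCMField.complexConj L ≠ 1 := IsCMField.complexConj_ne_one L
  have ht0 := gramD_gram_realDiagonal_entry_ne_zero L e dV hdV dW hdW hdV0 hdW0
  have hTd := gramD_eq_diagonal_cm L e dV hdV dW hdW
  exact isArchHalf_twist_archLift L e dV hdV hdV0 dW hdW hdW0
    (UnitaryGroup.archToAdelic (Fp L) L (IsCMField.complexConj L) (n + n) (hermD L e dV hdV dW hdW)) rfl
    (scaledFrame (Fp L) (Fin (n + n))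
      (placeScale (n + n) fun v => sqrtAbs (signVec (cmPlaceOver L)
        (fun k => Sum.elim (cmGramEntry L e dV hdV dW hdW) (-cmGramEntry L e dV hdV dW hdW)
          ((LocalSplitting.e₂ n).symm k)) (imagUnit L) v))
      (placeScale_ne_zero (n + n) (sqrtAbs_signVec_ne_zero hc (cmPlaceOver_smul L) (complexConj_imagUnit L)
        (imagUnit_ne_zero L) ht0)))
    (archWeilSectionS L (IsCMField.complexConj L) (n + n) hc (cmPlaceOver L) (cmPlaceOver_smul L) (cmPlaceOver_comap L)
      _ ht0 hTd (J := hermD L e dV hdV dW hdW) rfl (complexConj_imagUnit L) (imagUnit_ne_zero L))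
    (adelicToSymplectic_comp_archToAdelic_finVec L (IsCMField.complexConj L) (n + n) (J := hermD L e dV hdV dW hdW)
      (T := gramD L e dV hdV dW hdW) rfl (complexConj_imagUnit L) (imagUnit_ne_zero L) (imagUnit_mul_self L)
      (gramD_isSymm L e dV hdV dW hdW))
    (archPhaseMap_eq_coe_proj_archWeilSectionS L (IsCMField.complexConj L) (n + n) hc (cmPlaceOver L)
      (cmPlaceOver_smul L) (cmPlaceOver_comap L) _ ht0 hTd (J := hermD L e dV hdV dW hdW) rfl
      (complexConj_imagUnit L) (imagUnit_ne_zero L) (imagUnit_mul_self L) (gramD_isSymm L e dV hdV dW hdW)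
      (isUnit_archMat_gramDA L e dV hdV hdV0 dW hdW hdW0))
    (archWeilHalfD L e dV hdV hdV0 dW hdW hdW0) rfl χ
    (continuous_archWeilHalf L (IsCMField.complexConj L) (n + n) hc (cmPlaceOver L) (cmPlaceOver_smul L)
      (cmPlaceOver_comap L) _ ht0 hTd (J := hermD L e dV hdV dW hdW) rfl (complexConj_imagUnit L) (imagUnit_ne_zero L)
      (imagUnit_mul_self L) (gramD_isSymm L e dV hdV dW hdW) (isUnit_archMat_gramDA L e dV hdV hdV0 dW hdW hdW0))
    (etaD L e dV hdV dW hdW t) (continuous_coe_archDetZPow _ _ _ _ _ _ _ _ _)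
    (fun g hS => by rw [quot_archWeilSectionS]; exact etaD_sq_mul_prod_inv_eq_chiDet L e dV hdV hdV0 dW hdW hdW0 ht hodd g hS)

/-- **The archimedean component of THE `χ`-normalised doubled Weil representation, EXPLICITLY**: for `χ` of odd unitary archimedean type
`(t, 0)`, `doubledWeilRep χ (g_∞, 1) = (archWeilHalf ⊗ η_t) g_∞` — hence the archimedean component of [HarrisKudlaSweet1996]'s `ι̃_{V,χ}`
∕ [Liu2021, App. D Step 2]'s `ι_μ` is Folland's section times `∏_v det(g_{w(v)})^{(t_{w(v)}+1)/2}`. [cite: Kudla1994, §3 Thm. 3.1]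
[cite: GelbartRogawski1991, §3.1 Prop. 3.1.1 p. 455 L1–2] -/
theorem doubledWeilRep_archToAdelic_eq_archHalfOf {χ : HeckeCharacter L} (hχu : χ.IsUnitary) (hχs : IsSplittingChar L 1 χ)
    {t : InfinitePlace L → ℤ} (ht : χ.HasUnitaryArchType t 0) (hodd : ∀ w, Odd (t w))
    (g : UnitaryGroup.arch (Fp L) L (IsCMField.complexConj L) (n + n) (hermD L e dV hdV dW hdW)) :
    Def411WeilCarriersDoubling.doubledWeilRep L e dV hdV hdV0 dW hdW hdW0 χ hχu hχs
        (UnitaryGroup.archToAdelic (Fp L) L (IsCMField.complexConj L) (n + n) (hermD L e dV hdV dW hdW) g) =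
      archHalfOf L e dV hdV hdV0 dW hdW hdW0 t g :=
  Def411WeilCarriersDoubling.doubledWeilRep_archToAdelic_eq L e dV hdV hdV0 dW hdW hdW0 χ hχu hχs
    (isArchHalf_archHalfOf L e dV hdV hdV0 dW hdW hdW0 ht hodd) g

end Literature.NumberTheory.GelbartRogawski1991.GRConstruction

end

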